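import Literature.NumberTheory.LFunctions.MontgomeryVaughanLogMeansMajorant
import HarnessLib

/-!
# Proof of Montgomery–Vaughan 2001, Theorem 3: `S₁(x) ≪ |F(σ)| (σ−1)((σ−1)^{-4/π} + log x)`

Proofs only (no definitions, no named facts). DISCHARGES the named fact
`Literature.NumberTheory.LFunctions.MontgomeryVaughan2001_thm3` (H. L. Montgomery, R. C. Vaughan,
*Mean values of multiplicative functions*, Period. Math. Hungar. 43 (2001), Theorem 3, p. 201, (4)):
for `x ≥ 3`, `1 + 1/log x ≤ σ ≤ 2` and `f` totally multiplicative with `|f(n)| ≤ 1`,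
`S₁(x) = Σ_{n ≤ x} f(n)/n ≪ |F(σ)| (σ−1) ((σ−1)^{-4/π} + log x)`, the implied constant absolute — as
`MontgomeryVaughan2001_thm3_holds`.

## The argument (MV §3 "Theorem 2 ⇒ Theorem 3", as reproduced in Roy–Vatwani 2019 §§6–7, `k = 1`)

With `L = log x`, `δ = σ − 1`, `T₁(x) = Σ_{n ≤ x} f(n) log n/n`:

* `S₁(x) log x = T₁(x) + ∫_0^{L} S₁(e^w) dw` (the terms `T₂ + T₃` of Roy–Vatwani §6 are
  `Σ_{n ≤ x} f(n) log(x/n)/n = ∫_1^x S₁(u) du/u`), so `|S₁(x)| L ≤ |T₁(x)| + ∫_0^L |S₁(e^w)| dw`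
  (`norm_S₁_mul_log_le`);
* `|T₁(x)| ≤ 3 + K₁ ∫_0^L |S₁(e^w)| dw + K₁ (log L/L) M` for any majorant `M` of `|S₁(u)| log u` on
  `[1, x]` (`MontgomeryVaughanLogMeansT1.lean`, Roy–Vatwani (eq:bound T1)), and
  `∫_0^L |S₁(e^w)| dw ≤ K₂ |F(σ)| Φ`, `Φ = δL² + δ^{1−4/π}L + L^{4/π−1}/δ`
  (`MontgomeryVaughanLogMeansMajorant.lean`: Plancherel, Lemmas 1–2 and the box estimates, Roy–Vatwani
  (eq:T1 goal) with Lemma 7.3);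
* the monotonicity device of Roy–Vatwani ((eq:condition on x): "we only need to prove the inequality
  for those `x` with `|F₁(u)| log u < |F₁(x)| log x` for `u ≤ x`") in the form: take `M` to be the
  maximum of `|S₁(n)| log(n+1)` over `n ≤ x`, attained at `n₀`; either `n₀` is small (then `M ≪ 1`), or
  the two displays at `x = n₀` give `M ≤ 12 + 4(K₁+1)K₂|F(σ)|Φ` once `K₁ log L/L ≤ 1/4`
  (`norm_S₁_mul_log_le_of_large`, `exists_norm_S₁_mul_log_le`);
* finally `δ L ≥ 1` turns `Φ/L` into `≪ δ(δ^{-4/π} + L)`, and the additive constants are absorbed by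
  `|F(σ)| ≫ δ` (`exists_norm_LSeries_ge`).

Axioms: `propext`, `Classical.choice`, `Quot.sound` only.

## References
* [MontgomeryVaughan2001] H. L. Montgomery, R. C. Vaughan, *Mean values of multiplicative functions*,
  Period. Math. Hungar. 43 (2001), 199–214: Theorem 3 (p. 201, (4)) and §3 (proof of Theorem 2,
  Lemmas 1–2, (21)–(24)) (paywalled, doi:10.1023/a:1015202219630; not held — read through:)
* [RoyVatwani2019] A. Roy, A. Vatwani, *Zeros of partial sums of L-functions*, Adv. Math. 346 (2019),
  arXiv:1807.11093 (read: §6, pp. 13–15, proof of Thm 2.3 = MV Thm 2 for the class `𝒞(k)`,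
  "self-contained"; §7, pp. 16–18, Lemmas 7.1–7.3 and proof of Thm 2.4 = MV Thm 3 at `k = 1`).
-/

noncomputable section

open Complex Real MeasureTheory Set Filter Finset

namespace Literature.NumberTheory.LFunctions

namespace MontgomeryVaughan2001

open MellinPlancherel (psum)

/-! ### The decomposition `S₁(x) log x = T₁(x) + ∫_0^{log x} S₁(e^w) dw` -/

/-- The measure of `(0, L] ∩ [a, ∞)` is `(L − a)⁺` for `0 ≤ a`. [folklore] -/
theorem volume_Ioc_inter_Ici {a L : ℝ} (ha : 0 ≤ a) :
    volume (Set.Ioc 0 L ∩ Set.Ici a) = ENNReal.ofReal (L - a) := by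
  apply le_antisymm
  · calc volume (Set.Ioc 0 L ∩ Set.Ici a) ≤ volume (Set.Icc a L) :=
          measure_mono fun w hw => ⟨hw.2, hw.1.2⟩
      _ = ENNReal.ofReal (L - a) := Real.volume_Icc
  · calc ENNReal.ofReal (L - a) = volume (Set.Ioc a L) := Real.volume_Ioc.symm
      _ ≤ volume (Set.Ioc 0 L ∩ Set.Ici a) :=
          measure_mono fun w hw => ⟨⟨ha.trans_lt hw.1, hw.2⟩, hw.1.le⟩

/-- `∫_0^L 1[a ≤ w] c dw = (L − a) c` for `0 ≤ a ≤ L`. [folklore] -/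
theorem integral_indicator_Ici_const {a L : ℝ} (ha : 0 ≤ a) (haL : a ≤ L) (c : ℂ) :
    ∫ w in (0 : ℝ)..L, (Set.Ici a).indicator (fun _ => c) w = ((L - a : ℝ) : ℂ) * c := by
  rw [intervalIntegral.integral_of_le (ha.trans haL), setIntegral_indicator measurableSet_Ici,
    setIntegral_const, measureReal_def, volume_Ioc_inter_Ici ha, ENNReal.toReal_ofReal (by linarith),
    Complex.real_smul]

/-- **`S₁(x) log x = T₁(x) + ∫_0^{log x} S₁(e^w) dw`** for `x ≥ 1`
(`Σ_{n ≤ x} (f(n)/n) log(x/n) = ∫_1^x S₁(u) du/u`; Roy–Vatwani's `T₂ + T₃`).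
[cite: RoyVatwani2019, §6 (the identity before §6.1)] -/
theorem S₁_mul_log_eq (f : ℕ → ℂ) {x : ℝ} (hx : 1 ≤ x) :
    S₁ f x * (Real.log x : ℂ) =
      (∑ n ∈ Finset.Icc 1 ⌊x⌋₊, f n * (Real.log n : ℂ) / n) +
        ∫ w in (0 : ℝ)..Real.log x, S₁ f (Real.exp w) := by
  have hx0 : 0 < x := by linarith
  set L : ℝ := Real.log x with hL
  have hL0 : 0 ≤ L := Real.log_nonneg hx
  set X : ℕ := ⌊x⌋₊ with hX
  -- the integrand on `[0, L]` as a finite sum of indicators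
  have hpt : ∀ w ∈ Set.uIcc 0 L, S₁ f (Real.exp w) =
      ∑ n ∈ Finset.Icc 1 X, (Set.Ici (Real.log n)).indicator (fun _ => f n / n) w := by
    intro w hw
    rw [Set.uIcc_of_le hL0] at hw
    have hfloor : ⌊Real.exp w⌋₊ ≤ X := Nat.floor_le_floor (by
      calc Real.exp w ≤ Real.exp L := Real.exp_le_exp.2 hw.2
        _ = x := by rw [hL, Real.exp_log hx0])
    rw [S₁]
    have hset : Finset.Icc 1 ⌊Real.exp w⌋₊ = (Finset.Icc 1 X).filter (fun n => n ≤ ⌊Real.exp w⌋₊) := by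
      ext n; simp only [Finset.mem_Icc, Finset.mem_filter]; omega
    rw [hset, Finset.sum_filter]
    refine Finset.sum_congr rfl fun n hn => ?_
    rw [Finset.mem_Icc] at hn
    have hiff : n ≤ ⌊Real.exp w⌋₊ ↔ Real.log n ≤ w := MellinPlancherel.le_floor_exp_iff hn.1 w
    by_cases h : Real.log n ≤ w
    · rw [if_pos (hiff.2 h), Set.indicator_of_mem (show w ∈ Set.Ici (Real.log n) from h)]
    · rw [if_neg (fun h' => h (hiff.1 h')), Set.indicator_of_notMem (show w ∉ Set.Ici (Real.log n) from h)]
  have hint : ∀ n ∈ Finset.Icc 1 X, IntervalIntegrable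
      (fun w => (Set.Ici (Real.log n)).indicator (fun _ => f n / (n : ℂ)) w) volume 0 L := by
    intro n _
    have hc : IntervalIntegrable (fun _ : ℝ => f n / (n : ℂ)) volume 0 L := intervalIntegrable_const
    exact ⟨hc.1.indicator measurableSet_Ici, hc.2.indicator measurableSet_Ici⟩
  rw [intervalIntegral.integral_congr hpt, intervalIntegral.integral_finsetSum hint]
  have hterm : ∀ n ∈ Finset.Icc 1 X,
      ∫ w in (0 : ℝ)..L, (Set.Ici (Real.log n)).indicator (fun _ => f n / (n : ℂ)) w =
        ((L - Real.log n : ℝ) : ℂ) * (f n / n) := by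
    intro n hn
    rw [Finset.mem_Icc] at hn
    have hn0 : (0 : ℝ) < n := by exact_mod_cast hn.1
    have hlog0 : 0 ≤ Real.log n := Real.log_nonneg (by exact_mod_cast hn.1)
    have hlogL : Real.log n ≤ L := by
      rw [hL]; exact Real.log_le_log hn0 ((Nat.cast_le.2 hn.2).trans (Nat.floor_le hx0.le))
    exact integral_indicator_Ici_const hlog0 hlogL _
  rw [Finset.sum_congr rfl hterm, ← Finset.sum_add_distrib, S₁, Finset.sum_mul]
  refine Finset.sum_congr rfl fun n _ => ?_
  push_cast
  ring

/-- **`|S₁(x)| log x ≤ |T₁(x)| + ∫_0^{log x} |S₁(e^w)| dw`** for `x ≥ 1`.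
[cite: RoyVatwani2019, §6] -/
theorem norm_S₁_mul_log_le (f : ℕ → ℂ) {x : ℝ} (hx : 1 ≤ x) :
    ‖S₁ f x‖ * Real.log x ≤
      ‖∑ n ∈ Finset.Icc 1 ⌊x⌋₊, f n * (Real.log n : ℂ) / n‖ +
        ∫ w in (0 : ℝ)..Real.log x, ‖S₁ f (Real.exp w)‖ := by
  have hL0 : 0 ≤ Real.log x := Real.log_nonneg hx
  have h := S₁_mul_log_eq f hx
  have hn : ‖S₁ f x * (Real.log x : ℂ)‖ = ‖S₁ f x‖ * Real.log x := by
    rw [norm_mul, Complex.norm_real, Real.norm_of_nonneg hL0]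
  rw [← hn, h]
  exact (norm_add_le _ _).trans (add_le_add le_rfl (intervalIntegral.norm_integral_le_integral_norm hL0))

/-! ### `S₁` at `u` and at `⌊u⌋`; the size function `Φ` -/

/-- `S₁(u) = S₁(⌊u⌋)`. [folklore] -/
theorem S₁_eq_S₁_floor (f : ℕ → ℂ) (u : ℝ) : S₁ f u = S₁ f (⌊u⌋₊ : ℕ) := by
  rw [S₁, S₁, Nat.floor_natCast]

/-- `log(n+1) ≤ 2 log n` for `n ≥ 2`. [folklore] -/
private theorem log_succ_le_two_mul_log {n : ℕ} (hn : 2 ≤ n) : Real.log ((n : ℝ) + 1) ≤ 2 * Real.log n := by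
  have hn2 : (2 : ℝ) ≤ n := by exact_mod_cast hn
  rw [← Real.log_rpow (by linarith), Real.rpow_two]
  exact Real.log_le_log (by linarith) (by nlinarith)

/-- `log log y / log y ≤ 2/√(log y)` for `y > 1` (`log z ≤ 2√z`). [folklore] -/
theorem loglog_div_log_le {y : ℝ} (hy : 1 < y) :
    Real.log (Real.log y) / Real.log y ≤ 2 / Real.sqrt (Real.log y) := by
  have hL : 0 < Real.log y := Real.log_pos hy
  have h := Real.log_le_rpow_div hL.le (by norm_num : (0 : ℝ) < 1 / 2)
  rw [← Real.sqrt_eq_rpow] at h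
  have hs : 0 < Real.sqrt (Real.log y) := Real.sqrt_pos.2 hL
  rw [div_le_div_iff₀ hL hs]
  have hsq : Real.sqrt (Real.log y) * Real.sqrt (Real.log y) = Real.log y := Real.mul_self_sqrt hL.le
  nlinarith

/-- `Φ(L) = δL² + δ^{1−4/π}L + L^{4/π−1}/δ ≥ 0`. [folklore] -/
private theorem Phi_nonneg {δ L : ℝ} (hδ : 0 < δ) (hL : 0 ≤ L) :
    0 ≤ δ * L ^ 2 + δ ^ (1 - 4 / π) * L + L ^ (4 / π - 1) / δ := by
  have h1 : 0 ≤ δ ^ (1 - 4 / π) := Real.rpow_nonneg hδ.le _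
  have h2 : 0 ≤ L ^ (4 / π - 1) := Real.rpow_nonneg hL _
  positivity

/-- `Φ` is monotone in `L ≥ 0`. [folklore] -/
private theorem Phi_mono {δ L L' : ℝ} (hδ : 0 < δ) (hL'0 : 0 ≤ L') (hL'L : L' ≤ L) :
    δ * L' ^ 2 + δ ^ (1 - 4 / π) * L' + L' ^ (4 / π - 1) / δ ≤
      δ * L ^ 2 + δ ^ (1 - 4 / π) * L + L ^ (4 / π - 1) / δ := by
  obtain ⟨he1, _⟩ := four_div_pi_bounds
  have h1 : L' ^ 2 ≤ L ^ 2 := pow_le_pow_left₀ hL'0 hL'L 2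
  have h2 : L' ^ (4 / π - 1) ≤ L ^ (4 / π - 1) := Real.rpow_le_rpow hL'0 hL'L (by linarith)
  have h3 : L' ^ (4 / π - 1) / δ ≤ L ^ (4 / π - 1) / δ := div_le_div_of_nonneg_right h2 hδ.le
  have h4 : δ * L' ^ 2 ≤ δ * L ^ 2 := mul_le_mul_of_nonneg_left h1 hδ.le
  have h5 : δ ^ (1 - 4 / π) * L' ≤ δ ^ (1 - 4 / π) * L :=
    mul_le_mul_of_nonneg_left hL'L (Real.rpow_nonneg hδ.le _)
  linarith

/-- `K (log log y)/(log y) ≤ 1/4` once `y ≥ exp(4(4K+1)²)`. [folklore] -/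
private theorem mul_loglog_div_log_le {K y : ℝ} (hK : 0 < K)
    (hy : Real.exp (4 * (4 * K + 1) ^ 2) ≤ y) :
    K * (Real.log (Real.log y) / Real.log y) ≤ 1 / 4 := by
  have hpos : 0 < 4 * (4 * K + 1) ^ 2 := by positivity
  have hy1 : 1 < y := (Real.one_lt_exp_iff.2 hpos).trans_le hy
  have hy0 : 0 < y := by linarith
  have hLge : 4 * (4 * K + 1) ^ 2 ≤ Real.log y := (Real.le_log_iff_exp_le hy0).2 hy
  have hL0 : 0 < Real.log y := Real.log_pos hy1
  have h1 := loglog_div_log_le hy1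
  have hs : 2 * (4 * K + 1) ≤ Real.sqrt (Real.log y) := by
    rw [show 2 * (4 * K + 1) = Real.sqrt ((2 * (4 * K + 1)) ^ 2) by
      rw [Real.sqrt_sq (by positivity)]]
    exact Real.sqrt_le_sqrt (by nlinarith)
  have hs0 : 0 < Real.sqrt (Real.log y) := Real.sqrt_pos.2 hL0
  have h2 : 2 / Real.sqrt (Real.log y) ≤ 1 / (4 * K + 1) := by
    rw [div_le_div_iff₀ hs0 (by positivity)]; nlinarith
  have h3 : Real.log (Real.log y) / Real.log y ≤ 1 / (4 * K + 1) := h1.trans h2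
  have h4 : K * (1 / (4 * K + 1)) ≤ 1 / 4 := by
    rw [mul_one_div, div_le_div_iff₀ (by positivity) (by norm_num)]; linarith
  exact (mul_le_mul_of_nonneg_left h3 hK.le).trans h4

/-- The two displays at a large `y` (Roy–Vatwani (eq:bound T1) and (eq:T1 goal)), combined with
`S₁(y) log y = T₁(y) + ∫_0^{log y} S₁(e^w) dw` and `K₁ (log log y)/(log y) ≤ 1/4`:
`|S₁(y)| log y ≤ 3 + (K₁+1) K₂ |F(σ)| Φ(log y) + M/4` for any majorant `M` of `|S₁(u)| log u` on
`[1, y]`. [cite: RoyVatwani2019, §6 and §7.2 (proof of Theorem 2.4)] -/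
private theorem norm_S₁_mul_log_le_of_large {K₁ K₂ : ℝ} (hK₁ : 0 < K₁) (hK₂ : 0 < K₂)
    (hT : ∀ f : ℕ →*₀ ℂ, (∀ n, ‖f n‖ ≤ 1) → ∀ x : ℝ, Real.exp 500 ≤ x → ∀ M : ℝ, 0 ≤ M →
      (∀ u : ℝ, 1 ≤ u → u ≤ x → ‖S₁ f u‖ * Real.log u ≤ M) →
        ‖∑ n ∈ Finset.Icc 1 ⌊x⌋₊, f n * (Real.log n : ℂ) / n‖ ≤
          3 + K₁ * (∫ w in (0 : ℝ)..Real.log x, ‖S₁ f (Real.exp w)‖) +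
            K₁ * (Real.log (Real.log x) / Real.log x) * M)
    (hI : ∀ f : ℕ →*₀ ℂ, (∀ n, ‖f n‖ ≤ 1) → ∀ σ : ℝ, 1 < σ → σ ≤ 2 → ∀ L : ℝ, 1 ≤ L →
      ∫ w in (0 : ℝ)..L, ‖S₁ f (Real.exp w)‖ ≤
        K₂ * ‖LSeries (f ·) σ‖ *
          ((σ - 1) * L ^ 2 + (σ - 1) ^ (1 - 4 / π) * L + L ^ (4 / π - 1) / (σ - 1)))
    (f : ℕ →*₀ ℂ) (hf : ∀ n, ‖f n‖ ≤ 1) {σ : ℝ} (hσ : 1 < σ) (hσ2 : σ ≤ 2) {y : ℝ}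
    (h500 : Real.exp 500 ≤ y) (hK₁' : Real.exp (4 * (4 * K₁ + 1) ^ 2) ≤ y) {M : ℝ} (hM0 : 0 ≤ M)
    (hMprop : ∀ u : ℝ, 1 ≤ u → u ≤ y → ‖S₁ f u‖ * Real.log u ≤ M) :
    ‖S₁ f y‖ * Real.log y ≤
      3 + (K₁ + 1) * (K₂ * ‖LSeries (f ·) σ‖ *
        ((σ - 1) * Real.log y ^ 2 + (σ - 1) ^ (1 - 4 / π) * Real.log y +
          Real.log y ^ (4 / π - 1) / (σ - 1))) + 1 / 4 * M := by
  have hy1 : 1 ≤ y := le_trans (by have := Real.add_one_le_exp (500 : ℝ); linarith) h500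
  have hy0 : 0 < y := by linarith
  have hL1 : 1 ≤ Real.log y := by
    rw [Real.le_log_iff_exp_le hy0]
    exact le_trans (Real.exp_le_exp.2 (by norm_num)) h500
  have hTn := hT f hf y h500 M hM0 hMprop
  have hIn := hI f hf σ hσ hσ2 (Real.log y) hL1
  have hdec := norm_S₁_mul_log_le f hy1
  have hℓ : K₁ * (Real.log (Real.log y) / Real.log y) * M ≤ 1 / 4 * M :=
    mul_le_mul_of_nonneg_right (mul_loglog_div_log_le hK₁ hK₁') hM0
  have hK0 : (0 : ℝ) ≤ K₁ + 1 := by linarith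
  have h1 := mul_le_mul_of_nonneg_left hIn hK0
  have h2 := mul_le_mul_of_nonneg_left hIn hK₂.le
  linarith

/-- **The main inequality** (MV Theorem 2 and the box estimates, assembled, with the monotonicity
device): there are absolute `A ≥ 0`, `B > 0` such that for all totally multiplicative `f` with
`|f| ≤ 1`, `1 < σ ≤ 2`, `x ≥ 3`, `L = log x`, `δ = σ − 1`:
`|S₁(x)| log x ≤ A + B |F(σ)| (δL² + δ^{1−4/π}L + L^{4/π−1}/δ)`.
[cite: RoyVatwani2019, Theorem 2.3 with Lemma 7.3 (proof of Theorem 2.4)] -/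
theorem exists_norm_S₁_mul_log_le :
    ∃ A B : ℝ, 0 ≤ A ∧ 0 < B ∧ ∀ f : ℕ →*₀ ℂ, (∀ n, ‖f n‖ ≤ 1) → ∀ σ : ℝ, 1 < σ → σ ≤ 2 →
      ∀ x : ℝ, 3 ≤ x →
        ‖S₁ f x‖ * Real.log x ≤
          A + B * ‖LSeries (f ·) σ‖ *
            ((σ - 1) * Real.log x ^ 2 + (σ - 1) ^ (1 - 4 / π) * Real.log x +
              Real.log x ^ (4 / π - 1) / (σ - 1)) := by
  obtain ⟨K₁, hK₁, hT⟩ := exists_norm_T₁_le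
  obtain ⟨K₂, hK₂, hI⟩ := exists_integral_norm_S₁_le
  obtain ⟨X₀, hX₀⟩ : ∃ X₀ : ℝ, X₀ = max (Real.exp 500) (Real.exp (4 * (4 * K₁ + 1) ^ 2)) :=
    ⟨_, rfl⟩
  have hX₀a : Real.exp 500 ≤ X₀ := hX₀ ▸ le_max_left _ _
  have hX₀b : Real.exp (4 * (4 * K₁ + 1) ^ 2) ≤ X₀ := hX₀ ▸ le_max_right _ _
  have hX₀1 : 1 ≤ X₀ := le_trans (by have := Real.add_one_le_exp (500 : ℝ); linarith) hX₀a
  have hX₀pos : 0 < X₀ := by linarith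
  have hlogX₀ : 0 ≤ Real.log X₀ := Real.log_nonneg hX₀1
  have hlogX₀1 : 0 ≤ Real.log (X₀ + 1) := Real.log_nonneg (by linarith)
  have hM₀0 : 0 ≤ (1 + Real.log X₀) * Real.log (X₀ + 1) := mul_nonneg (by linarith) hlogX₀1
  refine ⟨(1 + Real.log X₀) * Real.log (X₀ + 1) + 12, 4 * (K₁ + 1) * K₂, by positivity,
    by positivity, fun f hf σ hσ hσ2 x hx => ?_⟩
  have hx0 : 0 < x := by linarith
  have hx1 : (1 : ℝ) ≤ x := by linarith
  have hL1 : 1 ≤ Real.log x := by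
    rw [Real.le_log_iff_exp_le hx0]
    exact le_trans (by have := Real.exp_one_lt_d9; linarith) hx
  have hL0 : 0 < Real.log x := by linarith
  have hδ : 0 < σ - 1 := by linarith
  have hF0 : 0 ≤ ‖LSeries (f ·) σ‖ := norm_nonneg _
  have hΦ0 := Phi_nonneg hδ hL0.le
  -- the maximum `M` of `|S₁(n)| log(n+1)` over `1 ≤ n ≤ ⌊x⌋`, attained at `n₀`
  have hX1 : 1 ≤ ⌊x⌋₊ := Nat.le_floor (by exact_mod_cast hx1)
  obtain ⟨n₀, hn₀mem, hmax⟩ := Finset.exists_max_image (Finset.Icc 1 ⌊x⌋₊)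
    (fun n : ℕ => ‖S₁ f n‖ * Real.log ((n : ℝ) + 1)) ⟨1, Finset.mem_Icc.2 ⟨le_rfl, hX1⟩⟩
  rw [Finset.mem_Icc] at hn₀mem
  obtain ⟨M, hM⟩ : ∃ M : ℝ, M = ‖S₁ f n₀‖ * Real.log ((n₀ : ℝ) + 1) := ⟨_, rfl⟩
  have hn₀1 : (1 : ℝ) ≤ n₀ := by exact_mod_cast hn₀mem.1
  have hn₀x : (n₀ : ℝ) ≤ x := (Nat.cast_le.2 hn₀mem.2).trans (Nat.floor_le hx0.le)
  have hM0 : 0 ≤ M := hM ▸ mul_nonneg (norm_nonneg _) (Real.log_nonneg (by linarith))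
  -- `|S₁(u)| log u ≤ M` on `[1, x]`
  have hMprop : ∀ u : ℝ, 1 ≤ u → u ≤ x → ‖S₁ f u‖ * Real.log u ≤ M := by
    intro u hu1 hux
    have hfl1 : 1 ≤ ⌊u⌋₊ := Nat.le_floor (by exact_mod_cast hu1)
    have hflX : ⌊u⌋₊ ≤ ⌊x⌋₊ := Nat.floor_le_floor hux
    have hmem : ⌊u⌋₊ ∈ Finset.Icc 1 ⌊x⌋₊ := Finset.mem_Icc.2 ⟨hfl1, hflX⟩
    have h1 : ‖S₁ f u‖ = ‖S₁ f (⌊u⌋₊ : ℕ)‖ := by rw [S₁_eq_S₁_floor]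
    have h2 : Real.log u ≤ Real.log ((⌊u⌋₊ : ℝ) + 1) :=
      Real.log_le_log (by linarith) (Nat.lt_floor_add_one u).le
    have h3 : ‖S₁ f (⌊u⌋₊ : ℕ)‖ * Real.log ((⌊u⌋₊ : ℝ) + 1) ≤
        ‖S₁ f n₀‖ * Real.log ((n₀ : ℝ) + 1) := hmax _ hmem
    calc ‖S₁ f u‖ * Real.log u ≤ ‖S₁ f (⌊u⌋₊ : ℕ)‖ * Real.log ((⌊u⌋₊ : ℝ) + 1) := by
          rw [h1]; exact mul_le_mul_of_nonneg_left h2 (norm_nonneg _)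
      _ ≤ M := h3.trans_eq hM.symm
  -- the key bound on `M`
  have hkey : M ≤ (1 + Real.log X₀) * Real.log (X₀ + 1) + 12 +
      4 * (K₁ + 1) * K₂ * ‖LSeries (f ·) σ‖ *
        ((σ - 1) * Real.log x ^ 2 + (σ - 1) ^ (1 - 4 / π) * Real.log x +
          Real.log x ^ (4 / π - 1) / (σ - 1)) := by
    have hB0 : 0 ≤ 4 * (K₁ + 1) * K₂ * ‖LSeries (f ·) σ‖ := by positivity
    have hmain0 := mul_nonneg hB0 hΦ0
    rcases lt_or_ge (n₀ : ℝ) X₀ with hsmall | hbig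
    · -- `n₀ < X₀`: `M ≤ M₀`
      have h1 : ‖S₁ f n₀‖ ≤ 1 + Real.log n₀ := by
        have := norm_S₁_exp_le f hf (Real.log_nonneg hn₀1)
        rwa [Real.exp_log (by linarith)] at this
      have h2 : Real.log (n₀ : ℝ) ≤ Real.log X₀ := Real.log_le_log (by linarith) hsmall.le
      have h3 : Real.log ((n₀ : ℝ) + 1) ≤ Real.log (X₀ + 1) :=
        Real.log_le_log (by linarith) (by linarith)
      have h4 : 0 ≤ Real.log ((n₀ : ℝ) + 1) := Real.log_nonneg (by linarith)
      have h5 : M ≤ (1 + Real.log X₀) * Real.log (X₀ + 1) := by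
        rw [hM]; exact mul_le_mul (h1.trans (by linarith)) h3 h4 (by linarith)
      linarith
    · -- `n₀ ≥ X₀`: the two displays at `y = n₀`
      have h500 : Real.exp 500 ≤ n₀ := hX₀a.trans hbig
      have hK₁' : Real.exp (4 * (4 * K₁ + 1) ^ 2) ≤ n₀ := hX₀b.trans hbig
      have hn₀pos : (0 : ℝ) < n₀ := by linarith
      have hL'1 : 1 ≤ Real.log n₀ := by
        rw [Real.le_log_iff_exp_le hn₀pos]
        exact le_trans (Real.exp_le_exp.2 (by norm_num)) h500
      have hL'L : Real.log n₀ ≤ Real.log x := Real.log_le_log hn₀pos hn₀x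
      have hn₀2 : 2 ≤ n₀ := by
        have : (2 : ℝ) ≤ n₀ :=
          le_trans (by have := Real.add_one_le_exp (500 : ℝ); linarith) h500
        exact_mod_cast this
      have hQ := norm_S₁_mul_log_le_of_large hK₁ hK₂ hT hI f hf hσ hσ2 h500 hK₁' hM0
        (fun u hu1 hun => hMprop u hu1 (hun.trans hn₀x))
      have hΦL' := Phi_mono (δ := σ - 1) hδ (zero_le_one.trans hL'1) hL'L
      have hKF : 0 ≤ (K₁ + 1) * (K₂ * ‖LSeries (f ·) σ‖) := by positivity
      have hstep := mul_le_mul_of_nonneg_left hΦL' hKF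
      have hM2 : M ≤ 2 * (‖S₁ f n₀‖ * Real.log n₀) := by
        rw [hM]
        calc ‖S₁ f n₀‖ * Real.log ((n₀ : ℝ) + 1) ≤ ‖S₁ f n₀‖ * (2 * Real.log n₀) :=
              mul_le_mul_of_nonneg_left (log_succ_le_two_mul_log hn₀2) (norm_nonneg _)
          _ = 2 * (‖S₁ f n₀‖ * Real.log n₀) := by ring
      linarith
  -- conclusion
  linarith [hMprop x hx1 le_rfl]

/-- `L^{4/π−2}/δ ≤ δ^{1−4/π}` when `δ L ≥ 1`, `L ≥ 1`, `0 < δ` (the final observation of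
Roy–Vatwani's proof of Theorem 2.4: "since `σ−1 ≫ 1/log x`, `(σ−1)^{k(1−4/π)}(log x)^{k−1} ≫
(log x)^{4k/π−k−1}/(σ−1)^k`"). [cite: RoyVatwani2019, end of §7.2] -/
theorem rpow_div_le_rpow {δ L : ℝ} (hδ : 0 < δ) (hL : 1 ≤ L) (hδL : 1 ≤ δ * L) :
    L ^ (4 / π - 1) / L / δ ≤ δ ^ (1 - 4 / π) := by
  obtain ⟨he1, he2⟩ := four_div_pi_bounds
  have hL0 : 0 < L := by linarith
  set κ : ℝ := 4 / π - 1 with hκ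
  have hκ0 : 0 < κ := by rw [hκ]; linarith
  have hκ1 : κ < 1 := by rw [hκ]; linarith
  -- `L^{κ}/L = (1/L)^{1−κ} ≤ δ^{1−κ}`
  have h1 : L ^ κ / L = (1 / L) ^ (1 - κ) := by
    rw [← Real.rpow_sub_one hL0.ne', one_div, Real.inv_rpow hL0.le, ← Real.rpow_neg hL0.le]
    congr 1; ring
  have h2 : (1 / L) ^ (1 - κ) ≤ δ ^ (1 - κ) := by
    refine Real.rpow_le_rpow (by positivity) ?_ (by linarith)
    rw [div_le_iff₀ hL0]; linarith
  have h3 : δ ^ (1 - κ) / δ = δ ^ (1 - 4 / π) := by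
    rw [show (1 : ℝ) - 4 / π = (1 - κ) - 1 by rw [hκ]; ring, Real.rpow_sub_one hδ.ne']
  rw [h1, ← h3]
  exact div_le_div_of_nonneg_right h2 hδ.le

end MontgomeryVaughan2001

open MontgomeryVaughan2001

/-- **Montgomery–Vaughan 2001, Theorem 3 — proved** (discharge of `MontgomeryVaughan2001_thm3`):
there is an absolute `C > 0` such that for every totally multiplicative `f` with `|f(n)| ≤ 1`, all
`x ≥ 3` and `1 + 1/log x ≤ σ ≤ 2`,
`|S₁(x)| ≤ C |F(σ)| (σ−1) ((σ−1)^{-4/π} + log x)`.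
Proof: the main inequality `|S₁(x)| log x ≤ A + B|F(σ)|(δL² + δ^{1−4/π}L + L^{4/π−1}/δ)` (MV
Theorem 2 with the box estimates of Lemmas 1–2, via Roy–Vatwani §§6–7 at `k = 1`), divided by
`L = log x`, with `L^{4/π−2}/δ ≤ δ^{1−4/π}` (as `δL ≥ 1`) and the additive constant absorbed by
`|F(σ)| ≫ δ` and `δ^{1−4/π} ≥ 1`. [cite: MontgomeryVaughan2001, Theorem 3] -/
theorem MontgomeryVaughan2001_thm3_holds : MontgomeryVaughan2001_thm3 := by
  obtain ⟨A, B, hA, hB, hmain⟩ := MontgomeryVaughan2001.exists_norm_S₁_mul_log_le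
  obtain ⟨cF, hcF, hFge⟩ := MontgomeryVaughan2001.exists_norm_LSeries_ge
  obtain ⟨he1, he2⟩ := MontgomeryVaughan2001.four_div_pi_bounds
  refine ⟨A / cF + 2 * B, by positivity, fun f hf x hx σ hσx hσ2 => ?_⟩
  have hx0 : 0 < x := by linarith
  set L : ℝ := Real.log x with hL
  have hL1 : 1 ≤ L := by
    rw [hL, Real.le_log_iff_exp_le hx0]
    exact le_trans (by have := Real.exp_one_lt_d9; linarith) hx
  have hL0 : 0 < L := by linarith
  have hσ : 1 < σ := lt_of_lt_of_le (by have := one_div_pos.2 hL0; linarith) hσx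
  have hδ : 0 < σ - 1 := by linarith
  have hδ1 : σ - 1 ≤ 1 := by linarith
  set δ : ℝ := σ - 1 with hδdef
  have hδL : 1 ≤ δ * L := by
    have : 1 / L ≤ δ := by rw [hδdef]; linarith
    rwa [div_le_iff₀ hL0] at this
  set Fσ : ℝ := ‖LSeries (f ·) σ‖ with hFσ
  have hF0 : 0 ≤ Fσ := norm_nonneg _
  have hFge' : cF * δ ≤ Fσ := hFge f hf σ hσ hσ2
  have h := hmain f hf σ hσ hσ2 x hx
  -- `δ^{1−4/π} ≥ 1`, `δ^{−4/π} ≥ 1`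
  have hδpow1 : 1 ≤ δ ^ (1 - 4 / π) := Real.one_le_rpow_of_pos_of_le_one_of_nonpos hδ hδ1 (by linarith)
  have hδpow2 : 1 ≤ δ ^ (-(4 / π)) := Real.one_le_rpow_of_pos_of_le_one_of_nonpos hδ hδ1 (by linarith)
  have hδpow : δ ^ (1 - 4 / π) = δ * δ ^ (-(4 / π)) := by
    rw [show (1 : ℝ) - 4 / π = 1 + -(4 / π) by ring, Real.rpow_add hδ, Real.rpow_one]
  -- the target quantity
  set Tgt : ℝ := Fσ * δ * (δ ^ (-(4 / π)) + L) with hTgt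
  have hTgt0 : 0 ≤ Tgt := by positivity
  -- (1) `Φ/L ≤ 2 δ (δ^{-4/π} + L)`
  have hΦ : (δ * L ^ 2 + δ ^ (1 - 4 / π) * L + L ^ (4 / π - 1) / δ) / L ≤ 2 * (δ * (δ ^ (-(4 / π)) + L)) := by
    have h1 : (δ * L ^ 2 + δ ^ (1 - 4 / π) * L + L ^ (4 / π - 1) / δ) / L =
        δ * L + δ ^ (1 - 4 / π) + L ^ (4 / π - 1) / L / δ := by field_simp
    rw [h1]
    have h2 := MontgomeryVaughan2001.rpow_div_le_rpow hδ hL1 hδL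
    rw [hδpow] at h2 ⊢
    nlinarith [mul_nonneg hδ.le (le_trans zero_le_one hδpow2)]
  -- (2) `A/L ≤ (A/cF) Fσ δ (δ^{-4/π} + L)`
  have hlow : cF ≤ Fσ * (δ ^ (-(4 / π)) + L) := by
    calc cF ≤ cF * δ ^ (1 - 4 / π) := le_mul_of_one_le_right hcF.le hδpow1
      _ = (cF * δ) * δ ^ (-(4 / π)) := by rw [hδpow]; ring
      _ ≤ Fσ * δ ^ (-(4 / π)) := mul_le_mul_of_nonneg_right hFge' (by positivity)
      _ ≤ Fσ * (δ ^ (-(4 / π)) + L) := by gcongr; linarith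
  have hAterm : A / L ≤ A / cF * Tgt := by
    have h1 : A / L ≤ A * δ := by
      rw [div_le_iff₀ hL0]; nlinarith
    have h3 : A * δ ≤ A / cF * Tgt := by
      rw [hTgt, div_mul_eq_mul_div, le_div_iff₀ hcF]
      have := mul_le_mul_of_nonneg_left hlow (by positivity : 0 ≤ A * δ)
      nlinarith
    exact h1.trans h3
  -- (3) `B Fσ Φ/L ≤ 2B Tgt`
  have hBterm : B * Fσ * ((δ * L ^ 2 + δ ^ (1 - 4 / π) * L + L ^ (4 / π - 1) / δ) / L) ≤ 2 * B * Tgt := by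
    have := mul_le_mul_of_nonneg_left hΦ (by positivity : 0 ≤ B * Fσ)
    rw [hTgt]; nlinarith
  -- conclusion: divide the main inequality by `L`
  have hdiv : ‖S₁ f x‖ ≤ A / L + B * Fσ * ((δ * L ^ 2 + δ ^ (1 - 4 / π) * L + L ^ (4 / π - 1) / δ) / L) := by
    have h' : ‖S₁ f x‖ ≤ (A + B * Fσ * (δ * L ^ 2 + δ ^ (1 - 4 / π) * L + L ^ (4 / π - 1) / δ)) / L := by
      rw [le_div_iff₀ hL0]; exact h
    refine h'.trans (le_of_eq ?_)
    field_simp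
  calc ‖S₁ f x‖ ≤ A / L + B * Fσ * ((δ * L ^ 2 + δ ^ (1 - 4 / π) * L + L ^ (4 / π - 1) / δ) / L) := hdiv
    _ ≤ A / cF * Tgt + 2 * B * Tgt := add_le_add hAterm hBterm
    _ = (A / cF + 2 * B) * ‖LSeries (f ·) σ‖ * (σ - 1) * ((σ - 1) ^ (-(4 / Real.pi)) + Real.log x) := by
        rw [hTgt]; ring

end Literature.NumberTheory.LFunctions
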